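import Summits.CriticalPhenomena.SAWScalingLimit.Theorems.SAWDevelopingMapObservableToSLEHullApproxDomain
import HarnessLib

/-!
# Crux `SAWDevelopingMap.ObservableToSLE` (stmt-CriticalPhenomena-10472), line `six-class-type-ladder`,
stub T2b′ `stub_carvedReduction_squeeze`: piece (G3′), JORDAN OUTER APPROXIMANTS OF A GENERAL
`*`-HULL (the hull of the limit carving is not a hull SUBDOMAIN: pinches, pockets)

Landing target:
`Summits/CriticalPhenomena/SAWScalingLimit/Theorems/SAWDevelopingMapObservableToSLETypeLadderCarvedReductionSqueezeOuterHull.lean`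
(`--supports stmt-CriticalPhenomena-10472`; registered sub-goal `stub_carvedReduction_outerHull`).

The outer side of the moving-carving squeeze needs, inside the common two-piece flat super-domain
`E` with chordal uniformizer `φ`, FIXED Jordan hull subdomains `M⁺ ⊇ M̂` of `E` whose hulls
swallow any prescribed far part `B` of the hull `A = cl(ℍ ∖ φ⁻¹ M̂)` of the LIMIT carving `M̂`.
The limit carving is only a simply connected domain (pinch points of touching limit hexagons,
slits, pockets), not a Dobrushin domain, so the floor line's STUB 4b
(`FloorRatio.stub_hullApproxDomain`, stated for a hull subdomain `D'`) does not apply verbatim;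
but its proof only ever uses the `*`-hull `A = φ.pullbackHull D'`.  This file records the
`*`-hull form, with the conclusions in half-plane coordinates:

* `stub_carvedReduction_outerHull` — for `*`-hulls `B`, `A` with `B` at distance `≥ r` from
  `F = cl(ℍ ∖ A)` there is a Jordan hull subdomain `D''` of `D` with
  `φ {w ∈ ℍ : dist(w, F) ≤ r/4} ⊆ D''` (so `φ(ℍ ∖ A) ⊆ D''`), `B ⊆ φ.pullbackHull D'' ⊆ A`, and
  the new hull at distance `≥ r/4` from `F` (clusters of `B`, thin smooth hulls around them in
  the separating neighbourhoods, swallowed one by one: `stub_hullApproxDomain_cluster/arcs/multi`).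

Sources: G. F. Lawler, O. Schramm, W. Werner, J. Amer. Math. Soc. 16 (2003) Lemma 2.1 (smooth
hulls are dense); M. H. A. Newman, Elements of the topology of plane sets of points (1939) V §11.
-/

noncomputable section

open scoped Topology NNReal
open Filter Set MeasureTheory Metric Complex Function Bornology
open Literature.Probability.RandomPlanarGeometry
open UpperHalfPlane (upperHalfPlaneSet isOpen_upperHalfPlaneSet)

namespace Summit.CriticalPhenomena.SAWScalingLimit.Theorems.ObservableToSLE.TypeLadder

open Summit.CriticalPhenomena.SAWScalingLimit.Theorems.ObservableToSLE.FloorRatio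
  (stub_hullApproxDomain_cluster stub_hullApproxDomain_arcs stub_hullApproxDomain_multi)

/-- In `ℍ`, a point at positive distance from `cl(ℍ ∖ A)` lies in `A`. -/
theorem mem_of_infDist_pos {A : Set ℂ} {w : ℂ} (hw : w ∈ upperHalfPlaneSet)
    (h : 0 < infDist w (closure (upperHalfPlaneSet \ A))) : w ∈ A := by
  by_contra hwA
  have : infDist w (closure (upperHalfPlaneSet \ A)) = 0 :=
    infDist_zero_of_mem (subset_closure ⟨hw, hwA⟩)
  linarith

/-- **Registered sub-goal `stub_carvedReduction_outerHull`** (crux item stmt-CriticalPhenomena-10472,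
stub T2b′ `stub_carvedReduction_squeeze`, piece (G3′) OUTER JORDAN APPROXIMANTS OF A `*`-HULL): let
`φ : (ℍ; 0, ∞) → (D; a, b)` be a chordal uniformizing map and `A, B ∈ 𝒬*` with every point of `B`
at distance `≥ r > 0` from `F = cl(ℍ ∖ A)`.  Then there is a (Jordan) hull subdomain `D''` of `D`
with `φ w ∈ D''` for every `w ∈ ℍ` with `dist(w, F) ≤ r/4` (in particular `φ(ℍ ∖ A) ⊆ D''`),
`B ⊆ φ.pullbackHull D'' ⊆ A`, and every point of `φ.pullbackHull D''` at distance `≥ r/4` from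
`F`.  (`*`-hull form of `FloorRatio.stub_hullApproxDomain`; same proof.)
[cite: LawlerSchrammWerner2003Restriction, Lemma 2.1] -/
theorem stub_carvedReduction_outerHull :
    ∀ (D : DobrushinDomain) (φ : ConformalEquiv upperHalfPlaneSet D.carrier) (A B : Set ℂ) (r : ℝ),
      D.IsChordalUniformizing φ → IsStarHull A → IsStarHull B → 0 < r →
      (∀ w ∈ B, r ≤ infDist w (closure (upperHalfPlaneSet \ A))) →
      ∃ D'' : DobrushinDomain, D.IsHullSubdomain D'' ∧
        (∀ w ∈ upperHalfPlaneSet, infDist w (closure (upperHalfPlaneSet \ A)) ≤ r / 4 →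
          φ w ∈ D''.carrier) ∧
        B ⊆ φ.pullbackHull D'' ∧ φ.pullbackHull D'' ⊆ A ∧
        ∀ w ∈ φ.pullbackHull D'', r / 4 ≤ infDist w (closure (upperHalfPlaneSet \ A)) := by
  intro D φ A B r hφ hA hB hr hfar
  classical
  set F : Set ℂ := closure (upperHalfPlaneSet \ A) with hFdef
  -- the pulled-back hull of a hull subdomain, in terms of its carrier
  have hpull : ∀ (D'' : DobrushinDomain),
      φ.pullbackHull D'' = closure (upperHalfPlaneSet \ φ.pullbackDomain D'') := fun D'' ↦ rfl
  -- the empty hull: take `D'' = D`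
  rcases B.eq_empty_or_nonempty with rfl | hBne
  · have hdom : φ.pullbackDomain D = upperHalfPlaneSet := by
      ext z
      exact ⟨fun hz ↦ hz.1, fun hz ↦ ⟨hz, φ.mapsTo hz⟩⟩
    have hhull : φ.pullbackHull D = ∅ := by
      rw [hpull, hdom, sdiff_self]; exact closure_empty
    refine ⟨D, MarkedDomain.isHullSubdomain_self D, fun w hw _ ↦ φ.mapsTo hw, empty_subset _, ?_, ?_⟩
    · rw [hhull]; exact empty_subset _
    · rw [hhull]; intro w hw; exact hw.elim
  -- clusters
  obtain ⟨S, hS, hBS, hpair⟩ := stub_hullApproxDomain_cluster A B r hA hB hBne hr hfar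
  -- separating neighbourhoods of the real fillings
  set U : Set ℂ → Set ℂ := fun C ↦
    (⋂ C' ∈ S.erase C, {w | infDist w (realFill C) < infDist w (realFill C')}) ∩
      {w | r / 4 < infDist w F} with hU
  have hUo : ∀ C, IsOpen (U C) := fun C ↦
    (isOpen_biInter_finset fun C' _ ↦
      isOpen_lt (continuous_infDist_pt _) (continuous_infDist_pt _)).inter
      (isOpen_lt continuous_const (continuous_infDist_pt _))
  have hRc : ∀ C ∈ S, IsClosed (realFill C) := fun C hC ↦ by
    have h := (hS C hC).1
    have hb : IsBoundedHull C := h.elim (fun h ↦ h.1.isBoundedHull) (fun h ↦ h.1.isBoundedHull)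
    exact hb.isClosed.union ((isCompact_Icc.image Complex.continuous_ofReal).isClosed)
  have hRU : ∀ C ∈ S, realFill C ⊆ U C := by
    intro C hC w hw
    refine ⟨mem_iInter₂.2 fun C' hC' ↦ ?_,
      lt_of_lt_of_le (by linarith : r / 4 < r / 2) ((hS C hC).2.2.2 w hw)⟩
    obtain ⟨hne, hC'S⟩ := Finset.mem_erase.1 hC'
    have hdisj : Disjoint (realFill C) (realFill C') :=
      hpair (Finset.mem_coe.2 hC) (Finset.mem_coe.2 hC'S) (Ne.symm hne)
    have hw' : w ∉ realFill C' := fun h ↦ Set.disjoint_left.1 hdisj hw h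
    have hne' : (realFill C').Nonempty := (hS C' hC'S).2.1.mono (subset_realFill C')
    show infDist w (realFill C) < infDist w (realFill C')
    rw [infDist_zero_of_mem hw]
    exact ((hRc C' hC'S).notMem_iff_infDist_pos hne').1 hw'
  have hUdisj : ∀ C ∈ S, ∀ C' ∈ S, C ≠ C' → Disjoint (U C) (U C') := by
    intro C hC C' hC' hne
    refine Set.disjoint_left.2 fun w hw hw' ↦ ?_
    have h1 : infDist w (realFill C) < infDist w (realFill C') :=
      mem_iInter₂.1 hw.1 C' (Finset.mem_erase.2 ⟨Ne.symm hne, hC'⟩)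
    have h2 : infDist w (realFill C') < infDist w (realFill C) :=
      mem_iInter₂.1 hw'.1 C (Finset.mem_erase.2 ⟨hne, hC⟩)
    linarith
  -- thin smooth hulls around the clusters
  have harc : ∀ C ∈ S, ∃ J : Set ℂ, IsArcHull J ∧ (0 : ℂ) ∉ J ∧ C ⊆ J ∧ J ⊆ U C := fun C hC ↦
    stub_hullApproxDomain_arcs C (U C) (hS C hC).1 (hS C hC).2.1 (hUo C) (hRU C hC)
  choose! J hJa hJ0 hCJ hJU using harc
  set SJ : Finset (Set ℂ) := S.image J with hSJ
  have hSJmem : ∀ {J' : Set ℂ}, J' ∈ SJ ↔ ∃ C ∈ S, J C = J' := by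
    intro J'; rw [hSJ, Finset.mem_image]
  have hSJarc : ∀ J' ∈ SJ, IsArcHull J' ∧ (0 : ℂ) ∉ J' := by
    intro J' hJ'
    obtain ⟨C, hC, rfl⟩ := hSJmem.1 hJ'
    exact ⟨hJa C hC, hJ0 C hC⟩
  have hSJpair : (SJ : Set (Set ℂ)).Pairwise Disjoint := by
    intro J₁ hJ₁ J₂ hJ₂ hne
    obtain ⟨C₁, hC₁, rfl⟩ := hSJmem.1 (Finset.mem_coe.1 hJ₁)
    obtain ⟨C₂, hC₂, rfl⟩ := hSJmem.1 (Finset.mem_coe.1 hJ₂)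
    have hC : C₁ ≠ C₂ := fun h ↦ hne (by rw [h])
    exact (hUdisj C₁ hC₁ C₂ hC₂ hC).mono (hJU C₁ hC₁) (hJU C₂ hC₂)
  -- points of the smooth hulls are far from `F`
  have hJfar : ∀ {w : ℂ}, w ∈ ⋃₀ (SJ : Set (Set ℂ)) → r / 4 < infDist w F := by
    rintro w ⟨J', hJ', hw⟩
    obtain ⟨C, hC, rfl⟩ := hSJmem.1 (Finset.mem_coe.1 hJ')
    exact (hJU C hC hw).2
  -- swallow the smooth hulls
  obtain ⟨D'', hD'', hcar⟩ := stub_hullApproxDomain_multi D φ SJ hφ hSJarc hSJpair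
  -- the new hull is `cl(⋃ J ∩ ℍ)`
  have hdom : φ.pullbackDomain D'' = upperHalfPlaneSet \ ⋃₀ (SJ : Set (Set ℂ)) := by
    ext z
    constructor
    · rintro ⟨hz, hzD⟩
      refine ⟨hz, fun hzJ ↦ ?_⟩
      rw [hcar] at hzD
      obtain ⟨z', hz', hzz'⟩ := hzD
      have : z' = z := φ.injOn hz'.1 hz hzz'
      exact hz'.2 (this ▸ hzJ)
    · rintro ⟨hz, hzJ⟩
      refine ⟨hz, ?_⟩
      rw [hcar]
      exact ⟨z, ⟨hz, hzJ⟩, rfl⟩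
  have hhull : φ.pullbackHull D'' = closure (⋃₀ (SJ : Set (Set ℂ)) ∩ upperHalfPlaneSet) := by
    rw [hpull, hdom]
    congr 1
    ext z
    simp only [Set.mem_sdiff, mem_inter_iff, not_and, not_not]
    tauto
  have hfarJ : ∀ w ∈ φ.pullbackHull D'', r / 4 ≤ infDist w F := by
    rw [hhull]
    intro w hw
    have hcont : Continuous fun w ↦ infDist w F := continuous_infDist_pt F
    exact closure_minimal (fun w hw ↦ (le_of_lt (hJfar hw.1) : r / 4 ≤ infDist w F))
      (isClosed_le continuous_const hcont) hw
  refine ⟨D'', hD'', ?_, ?_, ?_, hfarJ⟩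
  · -- the collar `dist(w, F) ≤ r/4` is swallowed
    intro w hw hwr
    have hwJ : w ∉ ⋃₀ (SJ : Set (Set ℂ)) := fun h ↦ by linarith [hJfar h]
    rw [hcar]
    exact ⟨w, ⟨hw, hwJ⟩, rfl⟩
  · -- `B ⊆ φ.pullbackHull D''`
    have hsub : B ∩ upperHalfPlaneSet ⊆ ⋃₀ (SJ : Set (Set ℂ)) ∩ upperHalfPlaneSet := by
      rintro b ⟨hbB, hbH⟩
      obtain ⟨C, hC, hbC⟩ := hBS hbB
      exact ⟨⟨J C, Finset.mem_coe.2 (hSJmem.2 ⟨C, Finset.mem_coe.1 hC, rfl⟩), hCJ C hC hbC⟩, hbH⟩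
    rw [← hB.isBoundedHull.closure_inter_eq, hhull]
    exact closure_mono hsub
  · -- `φ.pullbackHull D'' ⊆ A`
    intro w hw
    have hwr := hfarJ w hw
    -- `w ∈ cl(⋃ J ∩ ℍ)`; approximate by points of `ℍ` far from `F`, which lie in `A`
    rw [hhull] at hw
    refine hA.isBoundedHull.isClosed.closure_subset_iff.2 (fun z hz ↦ ?_) hw
    exact mem_of_infDist_pos hz.2 (lt_of_lt_of_le (by positivity) (le_of_lt (hJfar hz.1)))

end Summit.CriticalPhenomena.SAWScalingLimit.Theorems.ObservableToSLE.TypeLadder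

end
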